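import Literature.NumberTheory.LFunctions.FordZetaZeroDetector
import Literature.NumberTheory.LFunctions.FordLogZetaIntegralBound
import Literature.NumberTheory.LFunctions.VinogradovKorobovTrigIntegral
import Literature.NumberTheory.LFunctions.WeilZeroSum
import HarnessLib

/-!
# Ford's Lemma 4.1 (the zero detector for `ζ` with (3.1) inserted) at `s = 1 + it`, for every `η`

Topic `Literature/NumberTheory/LFunctions`, family RH (explicit Vinogradov–Korobov zero-free
regions). Everything in this file is PROVED; no named fact is introduced.

Ford 2002, **Lemma 4.1**: suppose `(3.1)` (`|ζ(σ + iy)| ≤ A t^{B(1−σ)^{3/2}} log^{2/3} t`,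
`1 ≤ |y| ≤ t`); let `s = σ + it`, `η > 0`, `σ − η ≥ 1/2`, `1 ≤ σ ≤ 1 + η`, `t ≥ 100`, and let `S`
be any set of zeros with `σ − η ≤ Re ρ ≤ 1`. Then
`−Re ζ'/ζ(s) ≤ −Σ_{ρ∈S} Re (π/2η) cot(π(s−ρ)/2η) + (1/2η)(⅔ log log t + B(1−σ+η)^{3/2} log t + log A)`
`   − (1/4η) ∫ log|ζ(s + η + 2ηiu/π)|/cosh²u du`.

Here it is obtained from the tree's whole-line detector for `ζ`
(`FordZetaDetector.ford_zero_detector_zeta`: Ford's Lemma 2.2 with `T → ∞` done) and Ford's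
Lemma 3.4 on the left line `Re z = σ − η` (`fordLogZetaIntegral_le_of_zeta_bound'`, `X = A`,
`Y = B(1−σ+η)^{3/2}`, `Z = 2/3`, `a = 2η/π`, the pointwise hypothesis from
`zeta_bound_of_richertBound`, hence `A ≥ 6`):

* `FordLemma41.ford_lemma_4_1_of_good` — the display above for `1 ≤ σ < 1 + η` when no zero of
  `ζ` lies on `Re z = σ − η`, with the pole of `ζ` accounted for by the extra non-negative term
  `(σ − 1)/|s − 1|²` (see `FordZetaZeroDetector.lean`: Ford drops the pole's contribution, which is
  `≥ 0` but `≈ e^{−πt/η}`, silently; it vanishes at `σ = 1`), and with Ford's finite set `S` of zeros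
  with `Re ρ > σ − η` (the sum written with the odd kernel `h_η(ρ − s)`, `h_η = (π/2η)cot(π·/2η)`);
* `FordLemma41.ford_lemma_4_1_one` — **the case `s = 1 + it` for every `0 < η ≤ 1/2`**, all
  `t ≥ 100`, every finite set `S` of zeros with `Re ρ > 1 − η`:
  `−Re ζ'/ζ(1+it) ≤ Σ_{ρ∈S} m(ρ) Re h_η(ρ − (1+it)) + (1/2η)(log A + Bη^{3/2} log t + ⅔ log log t)`
  `   − (1/4η) · fordLogZetaIntegral (1 + η) t (2η/π)`,
  which is the form consumed by Ford's Lemma 4.6 and by Mossinghoff–Trudgian–Yang's Lemmas 4.2 and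
  4.7 (`FordDetectorIneq` of `VinogradovKorobovZeroDetector.lean`). Lines `Re z = 1 − η` through
  zeros (e.g. `η = 1/2`) are treated as in Ford's proof of Lemma 4.6: apply the good case at
  abscissae `σ_n ↓ 1` (`exists_good_sigma`: the bad abscissae `Re ρ + η` are countably many) and let
  `n → ∞` (`tendsto_fordLogZetaIntegral`: dominated convergence on the right line with
  `|log|ζ|| ≤ (3/2)Σ_p p^{−1−η}`).

## References

* K. Ford, *Zero-free regions for the Riemann zeta function*, Number Theory for the Millennium II
  (Urbana 2000), A K Peters 2002, 25–56 (arXiv:1910.08205): Lemma 4.1, proof of Lemma 4.6.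
  [Ford2002Millennium]
* M. J. Mossinghoff, T. S. Trudgian, A. Yang, *Explicit zero-free regions for the Riemann
  zeta-function*, Res. Number Theory 10 (2024): Lemma 4.1, Lemma 4.2. [MossinghoffTrudgianYangRNT2024]
-/

noncomputable section

open Complex Set Metric Filter Topology MeasureTheory Real
open Literature.Analysis.Complex Literature.Analysis.Complex.FordDetector

namespace Literature.NumberTheory.LFunctions

namespace FordLemma41

/-! ### Lemma 4.1 for a good pair `(σ, η)` -/

/-- `e^{−x} ≤ 1/x` for `x > 0`. [folklore] -/
theorem exp_neg_le_one_div {x : ℝ} (hx : 0 < x) : Real.exp (-x) ≤ 1 / x := by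
  have h := Real.add_one_le_exp x
  rw [Real.exp_neg, inv_eq_one_div, div_le_div_iff₀ (Real.exp_pos x) hx]
  nlinarith

/-- **Ford 2002, Lemma 4.1** (with the pole term kept, cf. `FordZetaZeroDetector.lean`), for `σ`
with no zero of `ζ` on the line `Re z = σ − η`. Assume `(3.1)` in the form `RichertBound A B`
(`A ≥ 6`, `B ≥ 0`), `0 < η ≤ 1/2`, `1 ≤ σ < 1 + η`, `σ − η ≥ 1/2`, `t ≥ 100`,
`e^{−πt/2η} ≤ 1 − σ + η`, and let `S` be a finite set of zeros with `Re ρ > σ − η`. Then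
`−Re ζ'/ζ(s) ≤ (σ−1)/|s−1|² + Σ_{ρ∈S} m(ρ) Re h_η(ρ − s)`
`   + (1/2η)(log A + B(1 − σ + η)^{3/2} log t + (2/3) log log t) − (1/4η) ∫ log|ζ(s + η + 2ηiu/π)|/cosh²u du`
(Ford: `… − Σ_{ρ∈S} Re (π/2η)cot(π(s−ρ)/2η) + (1/2η)(⅔ log log t + B(1−σ+η)^{3/2} log t + log A) − (1/4η)∫…`;
`h_η` is odd). The left line `Re z = σ − η` is bounded by Ford's Lemma 3.4
(`fordLogZetaIntegral_le_of_zeta_bound'`, with `X = A`, `Y = B(1−σ+η)^{3/2}`, `Z = 2/3`,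
`a = 2η/π`, the hypothesis supplied by `zeta_bound_of_richertBound`).
[cite: Ford2002Millennium, Lemma 4.1] -/
theorem ford_lemma_4_1_of_good {A B σ t η : ℝ} (hA : 6 ≤ A) (hB : 0 ≤ B) (hR : RichertBound A B)
    (hη : 0 < η) (hη2 : η ≤ 1 / 2) (hσ : 1 ≤ σ) (hσ' : σ < 1 + η) (hleft : 1 / 2 ≤ σ - η)
    (ht : 100 ≤ t) (hexp : Real.exp (-(t / (2 * η / π))) ≤ 1 - σ + η)
    (hgood : ∀ ρ : ℂ, riemannZeta ρ = 0 → ρ.re ≠ σ - η)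
    (S : Finset ℂ) (hS : ∀ ρ ∈ S, riemannZeta ρ = 0 ∧ σ - η < ρ.re) :
    -(deriv riemannZeta (σ + t * I) / riemannZeta (σ + t * I)).re ≤
      (σ - 1) / ‖(σ : ℂ) + t * I - 1‖ ^ 2
      + (∑ ρ ∈ S, (riemannZetaZeroOrder ρ : ℝ) * (fordCot η (ρ - (σ + t * I))).re)
      + 1 / (2 * η) * (Real.log A + B * (1 - σ + η) ^ (3 / 2 : ℝ) * Real.log t
          + 2 / 3 * Real.log (Real.log t))
      - 1 / (4 * η) * fordLogZetaIntegral (σ + η) t (2 * η / π) := by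
  have ht0 : t ≠ 0 := by intro h; rw [h] at ht; norm_num at ht
  have hright : σ + η ≤ 3 := by linarith
  have h := FordZetaDetector.ford_zero_detector_zeta hη hσ hleft hright ht0 hgood S hS
  -- the two line integrals are `fordLogZetaIntegral`s
  have eL : (∫ u : ℝ, Real.log ‖riemannZeta ((σ - η : ℝ) + ((t + u * (2 * η / π) : ℝ) : ℂ) * I)‖ /
      Real.cosh u ^ 2) = fordLogZetaIntegral (σ - η) t (2 * η / π) := rfl
  have eR : (∫ u : ℝ, Real.log ‖riemannZeta ((σ + η : ℝ) + ((t + u * (2 * η / π) : ℝ) : ℂ) * I)‖ /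
      Real.cosh u ^ 2) = fordLogZetaIntegral (σ + η) t (2 * η / π) := rfl
  rw [eL, eR] at h
  -- Lemma 3.4 on the left line
  have ha : 0 < 2 * η / π := by positivity
  have ha2 : 2 * η / π ≤ 1 / 2 := by
    rw [div_le_iff₀ Real.pi_pos]
    have := Real.pi_gt_three
    nlinarith
  have hσ1 : σ - η < 1 := by linarith
  have hY : 0 ≤ B * (1 - (σ - η)) ^ (3 / 2 : ℝ) := mul_nonneg hB (Real.rpow_nonneg (by linarith) _)
  have hL := fordLogZetaIntegral_le_of_zeta_bound' (σ := σ - η) (X := A) (Y := B * (1 - (σ - η)) ^ (3 / 2 : ℝ))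
    (Z := 2 / 3) hleft hσ1 (by linarith) hY (by norm_num) (by norm_num; linarith [hY])
    (zeta_bound_of_richertBound hA hB hR hleft hσ1.le) ha ha2 ht (by rw [show 1 - (σ - η) = 1 - σ + η by ring]; exact hexp)
  rw [show 1 - (σ - η) = 1 - σ + η by ring] at hL
  have hη4 : 0 < 1 / (4 * η) := by positivity
  have key := mul_le_mul_of_nonneg_left hL hη4.le
  have e : 1 / (4 * η) * (2 * (Real.log A + B * (1 - σ + η) ^ (3 / 2 : ℝ) * Real.log t
      + 2 / 3 * Real.log (Real.log t))) = 1 / (2 * η) * (Real.log A + B * (1 - σ + η) ^ (3 / 2 : ℝ) *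
        Real.log t + 2 / 3 * Real.log (Real.log t)) := by
    field_simp; ring
  rw [e] at key
  rw [mul_sub] at h
  linarith

/-! ### Good abscissae near `1` -/

/-- Off the countably many abscissae `Re ρ + η`, arbitrarily close to `1⁺`: for `η, ε > 0` there
is `σ ∈ (1, 1 + ε)` with no zero of `ζ` on the line `Re z = σ − η`. [folklore] -/
theorem exists_good_sigma {η ε : ℝ} (hη : 0 < η) (hη1 : η < 1) (hε : 0 < ε) :
    ∃ σ : ℝ, 1 < σ ∧ σ < 1 + ε ∧ ∀ ρ : ℂ, riemannZeta ρ = 0 → ρ.re ≠ σ - η := by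
  set ε' : ℝ := min ε η with hε'
  have hε'0 : 0 < ε' := lt_min hε hη
  set Bad : Set ℝ := (fun ρ : ℂ ↦ ρ.re + η) '' ZetaZeros.riemannZetaNontrivialZeros with hBad
  have hcount : Bad.Countable := riemannZetaNontrivialZeros_countable.image _
  have hT : ¬ (Ioo 1 (1 + ε') ⊆ Bad) := by
    intro hsub
    have h0 : volume (Ioo (1 : ℝ) (1 + ε')) = 0 := measure_mono_null hsub (hcount.measure_zero volume)
    rw [Real.volume_Ioo] at h0
    have : ENNReal.ofReal (1 + ε' - 1) ≠ 0 := by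
      rw [ENNReal.ofReal_ne_zero_iff]; linarith
    exact this h0
  obtain ⟨σ, hσT, hσB⟩ := not_subset.1 hT
  refine ⟨σ, hσT.1, lt_of_lt_of_le hσT.2 (by linarith [min_le_left ε η]), fun ρ hρ hre ↦ hσB ?_⟩
  have hρre1 : 0 < ρ.re := by
    rw [hre]; linarith [hσT.1]
  have hρre2 : ρ.re < 1 := by
    have := min_le_right ε η; rw [hre]; linarith [hσT.2]
  refine ⟨ρ, (mem_riemannZetaNontrivialZeros_iff_holds).2 ⟨hρ, hρre1, hρre2⟩, ?_⟩
  simp only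
  rw [hre]; ring

/-! ### Continuity in `σ` of the right-line integral -/

/-- For `x ≥ x₀ > 1`, `|log|ζ(x + iy)|| ≤ (3/2) Σ_p p^{−x₀}`. [folklore] -/
theorem abs_log_norm_zeta_le_of_le {x₀ : ℝ} (hx₀ : 1 < x₀) {z : ℂ} (hz : x₀ ≤ z.re) :
    |Real.log ‖riemannZeta z‖| ≤ 3 / 2 * ∑' p : Nat.Primes, (p : ℝ) ^ (-x₀) := by
  have h := FordTrig.abs_log_norm_zeta_le (s := z) (by linarith)
  refine h.trans (mul_le_mul_of_nonneg_left ?_ (by norm_num))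
  refine Summable.tsum_le_tsum (fun p ↦ ?_) (FordTrig.summable_prime_rpow_neg (by linarith))
    (FordTrig.summable_prime_rpow_neg hx₀)
  have hp : (1 : ℝ) ≤ p := by exact_mod_cast p.2.one_lt.le
  exact Real.rpow_le_rpow_of_exponent_le hp (by linarith)

/-- **Continuity of `σ ↦ ∫ log|ζ(σ + η + i(t + au))|/cosh²u du` at `σ = 1`** along any
sequence `σ_n → 1` with `σ_n ≥ 1` (dominated convergence with the bound
`(3/2) Σ_p p^{−1−η}` on the lines `Re s ≥ 1 + η`). [folklore] -/
theorem tendsto_fordLogZetaIntegral {η t a : ℝ} (hη : 0 < η) {σs : ℕ → ℝ} (hσ1 : ∀ n, 1 ≤ σs n)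
    (hσ : Tendsto σs atTop (𝓝 1)) :
    Tendsto (fun n ↦ fordLogZetaIntegral (σs n + η) t a) atTop
      (𝓝 (fordLogZetaIntegral (1 + η) t a)) := by
  set M : ℝ := 3 / 2 * ∑' p : Nat.Primes, (p : ℝ) ^ (-(1 + η)) with hM
  simp only [fordLogZetaIntegral]
  -- continuity of `x ↦ log ‖ζ(x + c i)‖` for `x > 1`
  have hcont : ∀ (c : ℝ) {x : ℝ}, 1 < x →
      ContinuousAt (fun x : ℝ ↦ Real.log ‖riemannZeta ((x : ℂ) + (c : ℂ) * I)‖) x := by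
    intro c x hx
    have hz1 : (x : ℂ) + (c : ℂ) * I ≠ 1 := by
      intro h; have := congrArg Complex.re h; simp at this; linarith
    have hζ : riemannZeta ((x : ℂ) + (c : ℂ) * I) ≠ 0 :=
      riemannZeta_ne_zero_of_one_le_re (by simp; linarith)
    have h1 : ContinuousAt (fun x : ℝ ↦ riemannZeta ((x : ℂ) + (c : ℂ) * I)) x :=
      (differentiableAt_riemannZeta hz1).continuousAt.comp
        (f := fun x : ℝ ↦ (x : ℂ) + (c : ℂ) * I) (by fun_prop)
    exact (h1.norm).log (norm_ne_zero_iff.2 hζ)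
  refine tendsto_integral_filter_of_dominated_convergence (fun u ↦ M * (1 / Real.cosh u ^ 2)) ?_ ?_ ?_ ?_
  · refine Eventually.of_forall fun n ↦ ?_
    refine (Continuous.div ?_ (by fun_prop) fun u ↦ (pow_pos (Real.cosh_pos u) 2).ne').aestronglyMeasurable
    refine continuous_iff_continuousAt.2 fun u ↦ ?_
    have hn1 := hσ1 n
    have hz1 : ((σs n + η : ℝ) : ℂ) + ((t + u * a : ℝ) : ℂ) * I ≠ 1 := by
      intro h; have := congrArg Complex.re h; simp at this; linarith
    have hζ : riemannZeta (((σs n + η : ℝ) : ℂ) + ((t + u * a : ℝ) : ℂ) * I) ≠ 0 :=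
      riemannZeta_ne_zero_of_one_le_re (by simp; linarith)
    have h1 : ContinuousAt (fun u : ℝ ↦ riemannZeta (((σs n + η : ℝ) : ℂ) + ((t + u * a : ℝ) : ℂ) * I)) u :=
      (differentiableAt_riemannZeta hz1).continuousAt.comp
        (f := fun u : ℝ ↦ ((σs n + η : ℝ) : ℂ) + ((t + u * a : ℝ) : ℂ) * I) (by fun_prop)
    exact (h1.norm).log (norm_ne_zero_iff.2 hζ)
  · refine Eventually.of_forall fun n ↦ ae_of_all _ fun u ↦ ?_
    rw [Real.norm_eq_abs, abs_div, abs_of_pos (pow_pos (Real.cosh_pos u) 2), div_eq_mul_one_div]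
    refine mul_le_mul_of_nonneg_right ?_ (by positivity)
    exact abs_log_norm_zeta_le_of_le (by linarith) (by simp; linarith [hσ1 n])
  · exact (Literature.Analysis.SpecialFunctions.integrable_inv_cosh_sq).const_mul M
  · refine ae_of_all _ fun u ↦ ?_
    have h := hcont (t + u * a) (x := 1 + η) (by linarith)
    have h2 : Tendsto (fun n ↦ σs n + η) atTop (𝓝 (1 + η)) := hσ.add_const η
    have h3 := h.tendsto.comp h2
    simpa [Function.comp_def] using h3.div_const (Real.cosh u ^ 2)

/-! ### Lemma 4.1 at `s = 1 + it`, every `η` -/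

/-- **Ford 2002, Lemma 4.1 at `s = 1 + it`, for every `0 < η ≤ 1/2`.** Assume `(3.1)` as
`RichertBound A B` with `A ≥ 6`, `B ≥ 0`; let `t ≥ 100` and let `S` be any finite set of zeros of
`ζ` with `Re ρ > 1 − η`. Then
`−Re ζ'/ζ(1 + it) ≤ Σ_{ρ∈S} m(ρ) Re h_η(ρ − (1+it))`
`   + (1/2η)(log A + Bη^{3/2} log t + (2/3) log log t) − (1/4η) ∫ log|ζ(1 + η + it + 2ηiu/π)|/cosh²u du`.
This is exactly what Ford's Lemma 4.6 (and MTY Lemmas 4.2, 4.7) consume. The lines `Re z = 1 − η`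
carrying zeros (e.g. `η = 1/2`) are handled as in Ford's proof of Lemma 4.6: apply
`ford_lemma_4_1_of_good` at abscissae `σ_n ↓ 1` whose left lines avoid the zeros
(`exists_good_sigma`) and let `n → ∞` (`ζ'/ζ`, `h_η`, `(1 − σ + η)^{3/2}` are continuous; the
right-line integral by `tendsto_fordLogZetaIntegral`; the pole term tends to `0`).
[cite: Ford2002Millennium, Lemma 4.1 and proof of Lemma 4.6] -/
theorem ford_lemma_4_1_one {A B t η : ℝ} (hA : 6 ≤ A) (hB : 0 ≤ B) (hR : RichertBound A B)
    (hη : 0 < η) (hη2 : η ≤ 1 / 2) (ht : 100 ≤ t)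
    (S : Finset ℂ) (hS : ∀ ρ ∈ S, riemannZeta ρ = 0 ∧ 1 - η < ρ.re) :
    -(deriv riemannZeta (1 + t * I) / riemannZeta (1 + t * I)).re ≤
      (∑ ρ ∈ S, (riemannZetaZeroOrder ρ : ℝ) * (fordCot η (ρ - (1 + t * I))).re)
      + 1 / (2 * η) * (Real.log A + B * η ^ (3 / 2 : ℝ) * Real.log t
          + 2 / 3 * Real.log (Real.log t))
      - 1 / (4 * η) * fordLogZetaIntegral (1 + η) t (2 * η / π) := by
  -- good abscissae `σ_n ∈ (1, 1 + η/(n+2))`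
  have hch : ∀ n : ℕ, ∃ σ : ℝ, 1 < σ ∧ σ < 1 + η / (n + 2) ∧
      ∀ ρ : ℂ, riemannZeta ρ = 0 → ρ.re ≠ σ - η := fun n ↦
    exists_good_sigma hη (by linarith) (by positivity)
  choose σs hσ1 hσ2 hgood using hch
  have hσle : ∀ n, σs n ≤ 1 + η / 2 := fun n ↦ by
    have h1 := hσ2 n
    have h2 : η / (n + 2) ≤ η / 2 := div_le_div_of_nonneg_left hη.le (by norm_num) (by
      have := (Nat.cast_nonneg n : (0 : ℝ) ≤ n); linarith)
    linarith
  have hσ_tend : Tendsto σs atTop (𝓝 1) := by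
    have h0 : Tendsto (fun n : ℕ ↦ 1 + η / ((n : ℝ) + 2)) atTop (𝓝 (1 + 0)) :=
      tendsto_const_nhds.add ((tendsto_const_nhds (x := η)).div_atTop
        (tendsto_atTop_add_const_right atTop (2 : ℝ) tendsto_natCast_atTop_atTop))
    rw [add_zero] at h0
    exact tendsto_of_tendsto_of_tendsto_of_le_of_le tendsto_const_nhds h0 (fun n ↦ (hσ1 n).le)
      (fun n ↦ (hσ2 n).le)
  -- the inequality at `σ_n`, for `n` large
  have hexpη : Real.exp (-(t / (2 * η / π))) ≤ η / 2 := by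
    have hx : 0 < t / (2 * η / π) := by positivity
    refine (exp_neg_le_one_div hx).trans ?_
    rw [one_div_div, div_le_div_iff₀ (by positivity) (by norm_num)]
    have h4 : 4 / π < 2 := by rw [div_lt_iff₀ Real.pi_pos]; linarith [Real.pi_gt_three]
    rw [show 2 * η / π * 2 = η * (4 / π) by ring]
    exact mul_le_mul_of_nonneg_left (by linarith) hη.le
  have hevS : ∀ᶠ n in atTop, ∀ ρ ∈ S, σs n - η < ρ.re := by
    rw [eventually_all_finset]
    intro ρ hρ
    have h := (hS ρ hρ).2
    have : ∀ᶠ n in atTop, σs n < ρ.re + η :=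
      hσ_tend.eventually (eventually_lt_nhds (by linarith))
    exact this.mono fun n hn ↦ by linarith
  have hineq : ∀ᶠ n in atTop,
      -(deriv riemannZeta (σs n + t * I) / riemannZeta (σs n + t * I)).re ≤
        (σs n - 1) / ‖((σs n : ℝ) : ℂ) + t * I - 1‖ ^ 2
        + (∑ ρ ∈ S, (riemannZetaZeroOrder ρ : ℝ) * (fordCot η (ρ - (σs n + t * I))).re)
        + 1 / (2 * η) * (Real.log A + B * (1 - σs n + η) ^ (3 / 2 : ℝ) * Real.log t
            + 2 / 3 * Real.log (Real.log t))
        - 1 / (4 * η) * fordLogZetaIntegral (σs n + η) t (2 * η / π) := by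
    filter_upwards [hevS] with n hn
    exact ford_lemma_4_1_of_good hA hB hR hη hη2 (hσ1 n).le (by linarith [hσle n])
      (by linarith [hσ1 n]) ht (by linarith [hσle n, hexpη]) (hgood n) S
      (fun ρ hρ ↦ ⟨(hS ρ hρ).1, hn ρ hρ⟩)
  -- limits of the two sides
  have h1ne : (1 : ℂ) + t * I ≠ 1 := by
    intro h; have := congrArg Complex.im h; simp at this; rw [this] at ht; norm_num at ht
  have hζ1 : riemannZeta (1 + t * I) ≠ 0 := riemannZeta_ne_zero_of_one_le_re (by simp)
  have han : AnalyticAt ℂ riemannZeta (1 + t * I) := by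
    have hdiff : DifferentiableOn ℂ riemannZeta {(1 : ℂ)}ᶜ := fun z hz ↦
      (differentiableAt_riemannZeta hz).differentiableWithinAt
    exact hdiff.analyticAt (isOpen_compl_singleton.mem_nhds h1ne)
  have hL : Tendsto (fun n ↦ -(deriv riemannZeta (σs n + t * I) / riemannZeta (σs n + t * I)).re)
      atTop (𝓝 (-(deriv riemannZeta (1 + t * I) / riemannZeta (1 + t * I)).re)) := by
    have hc := continuousAt_logDeriv han hζ1
    have hφ : Tendsto (fun n ↦ ((σs n : ℝ) : ℂ) + t * I) atTop (𝓝 (1 + t * I)) := by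
      have := (Complex.continuous_ofReal.tendsto 1).comp hσ_tend
      simpa using this.add_const ((t : ℂ) * I)
    have := (Complex.continuous_re.tendsto _).comp (hc.tendsto.comp hφ)
    exact this.neg
  have hR : Tendsto (fun n ↦ (σs n - 1) / ‖((σs n : ℝ) : ℂ) + t * I - 1‖ ^ 2
        + (∑ ρ ∈ S, (riemannZetaZeroOrder ρ : ℝ) * (fordCot η (ρ - (σs n + t * I))).re)
        + 1 / (2 * η) * (Real.log A + B * (1 - σs n + η) ^ (3 / 2 : ℝ) * Real.log t
            + 2 / 3 * Real.log (Real.log t))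
        - 1 / (4 * η) * fordLogZetaIntegral (σs n + η) t (2 * η / π)) atTop
      (𝓝 (0 + (∑ ρ ∈ S, (riemannZetaZeroOrder ρ : ℝ) * (fordCot η (ρ - (1 + t * I))).re)
        + 1 / (2 * η) * (Real.log A + B * η ^ (3 / 2 : ℝ) * Real.log t
            + 2 / 3 * Real.log (Real.log t))
        - 1 / (4 * η) * fordLogZetaIntegral (1 + η) t (2 * η / π))) := by
    refine ((Tendsto.add (Tendsto.add ?_ ?_) ?_).sub ?_)
    · -- the pole term → 0
      have hφ : Tendsto (fun n ↦ ((σs n : ℝ) : ℂ) + t * I - 1) atTop (𝓝 (((1 : ℝ) : ℂ) + t * I - 1)) := by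
        have := (Complex.continuous_ofReal.tendsto 1).comp hσ_tend
        exact (this.add_const ((t : ℂ) * I)).sub_const 1
      have hnorm := ((continuous_norm.tendsto _).comp hφ).pow 2
      have hnum : Tendsto (fun n ↦ σs n - 1) atTop (𝓝 (1 - 1)) := hσ_tend.sub_const 1
      rw [sub_self] at hnum
      have hne : ‖((1 : ℝ) : ℂ) + t * I - 1‖ ^ 2 ≠ 0 := by
        have : ((1 : ℝ) : ℂ) + t * I - 1 = t * I := by push_cast; ring
        rw [this]
        have ht0 : t ≠ 0 := by intro h; rw [h] at ht; norm_num at ht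
        simp [ht0]
      have := hnum.div hnorm hne
      rw [zero_div] at this
      exact this
    · -- the zero terms
      refine tendsto_finsetSum _ fun ρ hρ ↦ Tendsto.const_mul _ ?_
      have hre := (hS ρ hρ).2
      have hρlt : ρ.re < 1 := by
        by_contra hge
        exact riemannZeta_ne_zero_of_one_le_re (not_lt.1 hge) (hS ρ hρ).1
      have hsin : Complex.sin (((π / (2 * η) : ℝ) : ℂ) * (ρ - (1 + t * I) - 0)) ≠ 0 := by
        rw [sub_zero]
        refine sin_ne_zero_of_abs_re_lt hη ?_ ?_
        · intro h
          have := congrArg Complex.re h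
          simp at this; linarith
        · simp only [sub_re, add_re, one_re, mul_re, ofReal_re, I_re, mul_zero, ofReal_im, I_im,
            mul_one, sub_self, add_zero]
          rw [abs_lt]; constructor <;> linarith
      have hca := (analyticAt_fordCot_sub (η := η) (z₀ := 0) hsin).continuousAt
      simp only [sub_zero] at hca
      have hφ : Tendsto (fun n ↦ ρ - (((σs n : ℝ) : ℂ) + t * I)) atTop (𝓝 (ρ - (1 + t * I))) := by
        have := (Complex.continuous_ofReal.tendsto 1).comp hσ_tend
        simpa using (this.add_const ((t : ℂ) * I)).const_sub ρ
      exact (Complex.continuous_re.tendsto _).comp (hca.tendsto.comp hφ)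
    · -- the explicit term
      refine Tendsto.const_mul _ (Tendsto.add (Tendsto.add tendsto_const_nhds ?_) tendsto_const_nhds)
      refine (Tendsto.mul_const _ (Tendsto.const_mul _ ?_))
      have hb : Tendsto (fun n ↦ 1 - σs n + η) atTop (𝓝 (1 - 1 + η)) :=
        (tendsto_const_nhds.sub hσ_tend).add_const η
      rw [sub_self, zero_add] at hb
      exact ((Real.continuousAt_rpow_const η (3 / 2) (Or.inr (by norm_num))).tendsto).comp hb
    · exact Tendsto.const_mul _ (tendsto_fordLogZetaIntegral hη (fun n ↦ (hσ1 n).le) hσ_tend)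
  rw [zero_add] at hR
  exact le_of_tendsto_of_tendsto hL hR hineq

end FordLemma41

end Literature.NumberTheory.LFunctions
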